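/-
CITATION HEADER
  module   : Literature.MathematicalPhysics.QuantumFieldTheory.Balaban1983to89.B4Block227Sharp
  package  : pub-balaban (surge node prover #09 gen 4, node 22, journal claim G-B4-227-GAP)
  papers   : [Balaban1983RegularityDecay] T. Balaban, "Regularity and decay of lattice Green's functions",
             Commun. Math. Phys. 89 (1983) 571–597 — (2.27) and the sentence before it, p. 580.
  printed  : the ONLY printed text this module refers to is the p. 580 sentence + display (2.27), quoted verbatim in
             `B4.Display227Printed` (b04, XREAD-verified there) and recalled in `B4Block227`; it is not re-quoted here.
             Everything below is [folklore] mathematics ABOUT the constant of that display (the Neumann gap of a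
             block); nothing of the paper is asserted.
  status   : kernel-checked, 0 sorry; all declarations [folklore].
-/
import Literature.MathematicalPhysics.QuantumFieldTheory.Balaban1983to89.B4Block227
import Literature.MathematicalPhysics.QuantumFieldTheory.Balaban1983to89.B6LayerSharp

/-!
# B4 (2.27) — the Neumann gap of a block identified: `4s² sin²(π/(2s))`; the printed display decided

`B4Block227` (b04) certified the REPAIRED block bound `min{8, a}·‖φ‖² ≤ ⟨φ,(−Δ^{η,N}_Δ + aP_k)φ⟩` on the block
`Δ = {0,…,n}^D` (side `s = n + 1`) and recorded, as its third HONEST-SCOPE item, that the EXACT gap `4s² sin²(π/2s)`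
was not certified ("only the uniform lower bound 8").  The census rows G-B4-03 / G-B4-03a state that the Neumann
gap of the discrete Laplacian on a block with `s ≥ 2` sites per direction is `4s² sin²(π/2s) ∈ [8, π²[` (in the
paper's `η = 1/s` units), never the printed `π²`.  This module kernel-checks exactly that, reusing the sharp
one-dimensional Neumann Poincaré inequality of `B6LayerSharp.neumann_path_sin` and the cosine test function of
`B6LayerCosine`:

* §1 the path `{0,…,n}`: `poincare_path_sharp : PoincareConst (pathSrc n) (pathTgt n) (1/(2 − 2cos(π/(n+1))))` and,
  for `n ≥ 1`, OPTIMALITY `le_of_poincare_path : PoincareConst … P → 1/(2 − 2cos(π/(n+1))) ≤ P` (`poincare_path_iff`);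
* §2 products and cubes: `le_of_poincare_prod` (a product bond system is never better than a factor),
  `poincare_cube_sharp` (every `d`, tensorisation `Beta.BlockPoincare.poincare_prod`), `le_of_poincare_cube`,
  `poincare_cube_iff` (`d ≥ 1`, `n ≥ 1`), and the coordinate form `poincare_coordCube_sharp`;
* §3 the gap constant `γ_s = s²(2 − 2cos(π/s)) = 4s² sin²(π/(2s))` (`gap_eq`) with `8 ≤ γ_s < π²` for `s ≥ 2`
  (`eight_le_gap`, `gap_lt_pi_sq`) — the interval `[8, π²[` of the census;
* §4 the concrete block form `B4Block227.blockForm n D a`: the SHARP repaired bound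
  `min{γ_s, a}·‖φ‖²_{L²(Δ)} ≤ ⟨φ,(−Δ^{η,N}_Δ + aP_k)φ⟩` (`blockForm_ineq_sharp`), a test configuration with
  `⟨φ,(−Δ^{η,N}_Δ + aP_k)φ⟩ = γ_s‖φ‖²`, `‖φ‖² > 0` (`blockForm_test`, dimension `≥ 1`, `s ≥ 2`), hence
  **`display227Printed_blockForm_iff`: on blocks of side `s ≥ 2` and dimension `≥ 1` the PRINTED (2.27)
  (`B4.Display227Printed`, constant `min{π², a}`) holds if and only if `a ≤ 4s² sin²(π/(2s))`** — in particular it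
  fails for `a = π²` (`not_display227Printed_pi_sq`) and holds in the paper's regime `a ≤ 8`
  (as `B4Block227.display227Printed_blockForm` already showed).

HONEST SCOPE: single blocks with free (Neumann) boundary and `A = 0` only, exactly as in `B4Block227` §4–§5;
nothing about `□`, `A ≠ 0`, or any other display of the paper.
-/

namespace Literature.MathematicalPhysics.QuantumFieldTheory.Balaban1983to89.B4Block227Sharp

open Finset Real
open Beta.BlockPoincare (avg variance dirichlet PoincareConst poincare_subsingleton pathSrc pathTgt prodSrc prodTgt
  dirichlet_prod Cube CubeBond cubeSrc cubeTgt poincare_prod sum_sq_eq_var_add)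
open Beta.CoordCubePoincare (coords stepUp dirichlet_coords variance_coords)
open B4Block227 (blockForm)
open B6LayerCosine (cosTest cosTest_eigen cosTest_ghost_left cosTest_ghost_right sum_cosTest cosTest_zero_pos
  dirichlet_eq_of_eigen two_sub_two_cos_eq sin_bound_lt_pi_sq_div)
open B6LayerUpperBound (sum_Ico_int_eq_sum_range)
open B6LayerSharp (neumann_path_sin)

noncomputable section

/-! ## §1  The path `{0,…,n}`: the sharp Poincaré constant `1/(2 − 2cos(π/(n+1)))` -/

/-- `0 < 2 − 2cos(π/(n+1))`. [folklore] -/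
theorem two_sub_two_cos_pos (n : ℕ) : 0 < 2 - 2 * cos (π / ((n : ℝ) + 1)) := by
  have hn : (1 : ℝ) ≤ (n : ℝ) + 1 := by
    have : (0 : ℝ) ≤ n := Nat.cast_nonneg n
    linarith
  have h1 : cos (π / ((n : ℝ) + 1)) < cos 0 :=
    cos_lt_cos_of_nonneg_of_le_pi (le_refl 0) (div_le_self pi_pos.le hn) (by positivity)
  rw [cos_zero] at h1
  linarith

/-- The sum and the sum of squares of the cosine test function on `{0,…,n}`: `Σ u = 0`, `Σ u² > 0` (n ≥ 1), and its
Dirichlet energy is `(2 − 2cos(π/(n+1)))·Σ u²`. [folklore] -/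
theorem cosTest_path {n : ℕ} (hn : 1 ≤ n) :
    (∑ j : Fin (n + 1), cosTest (n + 1) ((j : ℕ) : ℤ)) = 0 ∧
    0 < ∑ j : Fin (n + 1), cosTest (n + 1) ((j : ℕ) : ℤ) ^ 2 ∧
    dirichlet (pathSrc n) (pathTgt n) (fun j : Fin (n + 1) => cosTest (n + 1) ((j : ℕ) : ℤ))
      = (2 - 2 * cos (π / ((n : ℝ) + 1))) * ∑ j : Fin (n + 1), cosTest (n + 1) ((j : ℕ) : ℤ) ^ 2 := by
  have hL1 : 1 ≤ n + 1 := by omega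
  have hL2 : 2 ≤ n + 1 := by omega
  set u := cosTest (n + 1) with hu
  have hsum : (∑ j : Fin (n + 1), u ((j : ℕ) : ℤ)) = 0 := by
    have h := sum_cosTest hL1
    rw [sum_Ico_int_eq_sum_range] at h
    rw [Fin.sum_univ_eq_sum_range (fun k => u (k : ℤ)) (n + 1)]
    exact h
  have hsq : (∑ j : Fin (n + 1), u ((j : ℕ) : ℤ) ^ 2) = ∑ s ∈ range (n + 1), u s ^ 2 :=
    Fin.sum_univ_eq_sum_range (fun k => u (k : ℤ) ^ 2) (n + 1)
  have hS : 0 < ∑ s ∈ range (n + 1), u s ^ 2 := by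
    have h0 : u ((0 : ℕ) : ℤ) ^ 2 ≤ ∑ s ∈ range (n + 1), u s ^ 2 :=
      single_le_sum (f := fun s : ℕ => u s ^ 2) (fun s _ => sq_nonneg _) (mem_range.2 (by omega))
    have h1 : 0 < u 0 := cosTest_zero_pos hL2
    push_cast at h0
    nlinarith
  have hdir : dirichlet (pathSrc n) (pathTgt n) (fun j : Fin (n + 1) => u ((j : ℕ) : ℤ))
      = ∑ s ∈ range n, (u ((s : ℤ) + 1) - u s) ^ 2 := by
    unfold dirichlet
    rw [← Fin.sum_univ_eq_sum_range (fun s => (u ((s : ℤ) + 1) - u s) ^ 2) n]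
    refine sum_congr rfl fun k _ => ?_
    simp only [pathSrc, pathTgt, Fin.val_succ, Fin.val_castSucc, Nat.cast_add, Nat.cast_one]
  have hg : u ((n : ℤ) + 1) = u n := by
    have := cosTest_ghost_right hL1
    push_cast at this
    rwa [add_sub_cancel_right] at this
  refine ⟨hsum, by rw [hsq]; exact hS, ?_⟩
  rw [hdir, hsq, dirichlet_eq_of_eigen n u (2 * cos (π / (n + 1 : ℕ))) (cosTest_eigen hL1)
    (cosTest_ghost_left (n + 1)) hg]
  push_cast
  ring

/-- **Sharp Poincaré inequality on the path `{0,…,n}`** (free ends, `s = n + 1` points):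
`Σ (f − avg)² ≤ (1/(2 − 2cos(π/s)))·Σ_{k<n} (f(k+1) − f(k))²` — `B6LayerSharp.neumann_path_sin` in the language of
`Beta.BlockPoincare.PoincareConst`. [folklore] -/
theorem poincare_path_sharp (n : ℕ) :
    PoincareConst (pathSrc n) (pathTgt n) (1 / (2 - 2 * cos (π / ((n : ℝ) + 1)))) := by
  have hpos := two_sub_two_cos_pos n
  rcases Nat.eq_zero_or_pos n with rfl | hn
  · haveI : Subsingleton (Fin (0 + 1)) := ⟨fun a b => Fin.ext (by omega)⟩
    exact poincare_subsingleton _ _ _ (div_nonneg zero_le_one hpos.le)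
  intro f
  -- an `ℕ`-indexed copy of `f`
  let g : ℕ → ℝ := fun j => if h : j < n + 1 then f ⟨j, h⟩ else 0
  have hg : ∀ j : Fin (n + 1), f j = g j := fun j => by simp only [g, dif_pos j.isLt]
  have hdir : dirichlet (pathSrc n) (pathTgt n) f = ∑ k ∈ range n, (g (k + 1) - g k) ^ 2 := by
    unfold dirichlet
    rw [← Fin.sum_univ_eq_sum_range (fun k => (g (k + 1) - g k) ^ 2) n]
    refine sum_congr rfl fun k _ => ?_
    have h1 : f (pathTgt n k) = g (k + 1) := by rw [hg]; simp [pathTgt]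
    have h2 : f (pathSrc n k) = g k := by rw [hg]; simp [pathSrc]
    rw [h1, h2]
  have hS1 : (∑ i, f i) = ∑ k ∈ range (n + 1), g k := by
    rw [← Fin.sum_univ_eq_sum_range]
    exact sum_congr rfl fun i _ => hg i
  have hS2 : (∑ i, f i ^ 2) = ∑ k ∈ range (n + 1), g k ^ 2 := by
    rw [← Fin.sum_univ_eq_sum_range (fun k => g k ^ 2) (n + 1)]
    exact sum_congr rfl fun i _ => by rw [hg]
  have hn1 : (0 : ℝ) < (n : ℝ) + 1 := by positivity
  have hvar : variance f
      = ∑ k ∈ range (n + 1), g k ^ 2 - (∑ k ∈ range (n + 1), g k) ^ 2 / ((n : ℝ) + 1) := by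
    have h1 := sum_sq_eq_var_add (univ : Finset (Fin (n + 1))) f
    rw [Finset.card_univ, Fintype.card_fin] at h1
    have havg : avg univ f = (∑ k ∈ range (n + 1), g k) / ((n : ℝ) + 1) := by
      unfold avg
      rw [Finset.card_univ, Fintype.card_fin, hS1]
      push_cast
      rfl
    unfold variance
    rw [havg] at h1 ⊢
    rw [hS2] at h1
    push_cast at h1
    have e : ((n : ℝ) + 1) * ((∑ k ∈ range (n + 1), g k) / ((n : ℝ) + 1)) ^ 2
        = (∑ k ∈ range (n + 1), g k) ^ 2 / ((n : ℝ) + 1) := by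
      field_simp
    linarith
  have key := neumann_path_sin (L := n + 1) (by omega) g
  rw [Nat.add_sub_cancel] at key
  push_cast at key
  rw [hdir, hvar, one_div_mul_eq_div, le_div_iff₀ hpos, mul_comm]
  exact key

/-- **Optimality on the path**: for `n ≥ 1` every Poincaré constant of `{0,…,n}` is `≥ 1/(2 − 2cos(π/(n+1)))`
(test function `cos(π(2k+1)/(2(n+1)))`, the lowest non-constant Neumann mode). [folklore] -/
theorem le_of_poincare_path {n : ℕ} (hn : 1 ≤ n) {P : ℝ} (h : PoincareConst (pathSrc n) (pathTgt n) P) :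
    1 / (2 - 2 * cos (π / ((n : ℝ) + 1))) ≤ P := by
  obtain ⟨hsum, hS, hdir⟩ := cosTest_path hn
  set f : Fin (n + 1) → ℝ := fun j => cosTest (n + 1) ((j : ℕ) : ℤ) with hf
  have key := h f
  have havg : avg univ f = 0 := by unfold avg; rw [hsum, zero_div]
  have hvar : variance f = ∑ j : Fin (n + 1), f j ^ 2 := by
    unfold variance
    simp only [havg, sub_zero]
  rw [hvar, hdir] at key
  have hpos := two_sub_two_cos_pos n
  rw [div_le_iff₀ hpos]
  set S := ∑ j : Fin (n + 1), f j ^ 2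
  have : S * 1 ≤ S * (P * (2 - 2 * cos (π / ((n : ℝ) + 1)))) := by nlinarith
  exact le_of_mul_le_mul_left this hS

/-- **The optimal Poincaré constant of the path with `n + 1 ≥ 2` points is `1/(2 − 2cos(π/(n+1)))`.** [folklore] -/
theorem poincare_path_iff {n : ℕ} (hn : 1 ≤ n) {P : ℝ} :
    PoincareConst (pathSrc n) (pathTgt n) P ↔ 1 / (2 - 2 * cos (π / ((n : ℝ) + 1))) ≤ P :=
  ⟨le_of_poincare_path hn, fun hP => (poincare_path_sharp n).mono hP⟩

/-! ## §2  Products and cubes -/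

section Prod

variable {A C κA κC : Type*} [Fintype A] [Fintype C] [Fintype κA] [Fintype κC]

/-- A test function depending on the first factor only: its sum, sum of squares and product Dirichlet energy are
`|C|` times those of the factor. [folklore] -/
theorem first_factor_sums (sA tA : κA → A) (sC tC : κC → C) (f : A → ℝ) :
    (∑ p : A × C, f p.1) = Fintype.card C * ∑ a, f a ∧
    (∑ p : A × C, f p.1 ^ 2) = Fintype.card C * ∑ a, f a ^ 2 ∧
    dirichlet (prodSrc sA sC) (prodTgt tA tC) (fun p : A × C => f p.1)
      = Fintype.card C * dirichlet sA tA f := by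
  have h0 : ∀ a : A, dirichlet sC tC (fun _ : C => f a) = 0 := fun a => by
    unfold dirichlet
    simp
  refine ⟨?_, ?_, ?_⟩
  · rw [Fintype.sum_prod_type]
    simp only [Finset.sum_const, Finset.card_univ, nsmul_eq_mul]
    rw [← Finset.mul_sum]
  · rw [Fintype.sum_prod_type]
    simp only [Finset.sum_const, Finset.card_univ, nsmul_eq_mul]
    rw [← Finset.mul_sum]
  · rw [dirichlet_prod]
    simp only [h0, Finset.sum_const_zero, add_zero, Finset.sum_const, Finset.card_univ, nsmul_eq_mul]

/-- **A product bond system is never better than its first factor**: if `A` carries a mean-zero `f ≠ 0` whose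
Dirichlet energy is `c·Σf²`, then every Poincaré constant `P` of `A × C` (`C` nonempty) has `1 ≤ P·c`. [folklore] -/
theorem one_le_of_poincare_prod [Nonempty C] {sA tA : κA → A} {sC tC : κC → C} {P : ℝ}
    (h : PoincareConst (prodSrc sA sC) (prodTgt tA tC) P) (f : A → ℝ) (hf0 : (∑ a, f a) = 0)
    (hfpos : 0 < ∑ a, f a ^ 2) {c : ℝ} (hdir : dirichlet sA tA f = c * ∑ a, f a ^ 2) : 1 ≤ P * c := by
  obtain ⟨h1, h2, h3⟩ := first_factor_sums sA tA sC tC f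
  have key := h (fun p : A × C => f p.1)
  have hcard : (0 : ℝ) < Fintype.card C := by exact_mod_cast Fintype.card_pos
  have havg : avg univ (fun p : A × C => f p.1) = 0 := by
    unfold avg
    rw [h1, hf0, mul_zero, zero_div]
  have hvar : variance (fun p : A × C => f p.1) = Fintype.card C * ∑ a, f a ^ 2 := by
    unfold variance
    simp only [havg, sub_zero]
    exact h2
  rw [hvar, h3, hdir] at key
  set S := ∑ a, f a ^ 2
  have hCS : 0 < (Fintype.card C : ℝ) * S := mul_pos hcard hfpos
  have : (Fintype.card C : ℝ) * S * 1 ≤ (Fintype.card C : ℝ) * S * (P * c) := by nlinarith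
  exact le_of_mul_le_mul_left this hCS

end Prod

/-- **Sharp Poincaré inequality on the cube `{0,…,n}^d`, every `d`**, with the `d`-independent constant
`1/(2 − 2cos(π/(n+1)))` (tensorisation of §1). [folklore] -/
theorem poincare_cube_sharp (n : ℕ) :
    (d : ℕ) → PoincareConst (cubeSrc n d) (cubeTgt n d) (1 / (2 - 2 * cos (π / ((n : ℝ) + 1))))
  | 0 => by
    haveI : Subsingleton (Cube n 0) := inferInstanceAs (Subsingleton Unit)
    exact poincare_subsingleton _ _ _ (div_nonneg zero_le_one (two_sub_two_cos_pos n).le)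
  | d + 1 => by
    have h := poincare_prod (poincare_path_sharp n) (poincare_cube_sharp n d)
      (div_nonneg zero_le_one (two_sub_two_cos_pos n).le)
    rw [max_self] at h
    exact h

/-- **Optimality on the cube** (`n ≥ 1`, dimension `d + 1 ≥ 1`): every Poincaré constant of `{0,…,n}^{d+1}` is
`≥ 1/(2 − 2cos(π/(n+1)))`. [folklore] -/
theorem le_of_poincare_cube {n : ℕ} (hn : 1 ≤ n) (d : ℕ) {P : ℝ}
    (h : PoincareConst (cubeSrc n (d + 1)) (cubeTgt n (d + 1)) P) :
    1 / (2 - 2 * cos (π / ((n : ℝ) + 1))) ≤ P := by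
  obtain ⟨hsum, hS, hdir⟩ := cosTest_path hn
  have hpos := two_sub_two_cos_pos n
  have h' : PoincareConst (prodSrc (pathSrc n) (cubeSrc n d)) (prodTgt (pathTgt n) (cubeTgt n d)) P := h
  have key := one_le_of_poincare_prod h' _ hsum hS hdir
  rwa [div_le_iff₀ hpos]

/-- **The optimal Poincaré constant of the cube `{0,…,n}^{d+1}` (`n ≥ 1`) is `1/(2 − 2cos(π/(n+1)))`**, the same
for every dimension. [folklore] -/
theorem poincare_cube_iff {n : ℕ} (hn : 1 ≤ n) (d : ℕ) {P : ℝ} :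
    PoincareConst (cubeSrc n (d + 1)) (cubeTgt n (d + 1)) P ↔ 1 / (2 - 2 * cos (π / ((n : ℝ) + 1))) ≤ P :=
  ⟨le_of_poincare_cube hn d, fun hP => (poincare_cube_sharp n (d + 1)).mono hP⟩

/-- **The coordinate-cube form**: for every `g : (Fin d → Fin (n+1)) → ℝ`,
`Σ_y (g y − avg g)² ≤ (1/(2 − 2cos(π/(n+1))))·Σ_μ Σ_{y : y μ ≠ last} (g (y + e_μ) − g y)²`
(transport along `Beta.CoordCubePoincare.coords`, as in `B4Block227.poincare_coordCube8`). [folklore] -/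
theorem poincare_coordCube_sharp (n d : ℕ) (g : (Fin d → Fin (n + 1)) → ℝ) :
    ∑ y, (g y - avg Finset.univ g) ^ 2
      ≤ 1 / (2 - 2 * cos (π / ((n : ℝ) + 1))) * ∑ μ : Fin d,
          ∑ y ∈ Finset.univ.filter (fun y : Fin d → Fin (n + 1) => y μ ≠ Fin.last n),
            (g (stepUp y μ) - g y) ^ 2 := by
  have h := poincare_cube_sharp n d (g ∘ coords n d)
  rw [variance_coords] at h
  unfold dirichlet at h
  simpa only [Function.comp, dirichlet_coords n d g] using h

/-- **A coordinate-cube test function** (`n ≥ 1`, dimension `d + 1`): some `g` with `Σ g = 0`, `Σ g² > 0` and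
gradient energy exactly `(2 − 2cos(π/(n+1)))·Σ g²` (the cosine mode in the first coordinate). [folklore] -/
theorem coordCube_test {n : ℕ} (hn : 1 ≤ n) (d : ℕ) :
    ∃ g : (Fin (d + 1) → Fin (n + 1)) → ℝ,
      (∑ y, g y) = 0 ∧ 0 < ∑ y, g y ^ 2 ∧
      ∑ μ : Fin (d + 1), ∑ y ∈ Finset.univ.filter (fun y : Fin (d + 1) → Fin (n + 1) => y μ ≠ Fin.last n),
          (g (stepUp y μ) - g y) ^ 2 = (2 - 2 * cos (π / ((n : ℝ) + 1))) * ∑ y, g y ^ 2 := by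
  obtain ⟨hsum, hS, hdir⟩ := cosTest_path hn
  set f : Fin (n + 1) → ℝ := fun j => cosTest (n + 1) ((j : ℕ) : ℤ) with hf
  obtain ⟨h1, h2, h3⟩ := first_factor_sums (pathSrc n) (pathTgt n) (cubeSrc n d) (cubeTgt n d) f
  let F : Cube n (d + 1) → ℝ := fun p : Fin (n + 1) × Cube n d => f p.1
  refine ⟨F ∘ (coords n (d + 1)).symm, ?_, ?_, ?_⟩
  · have e : (∑ y, (F ∘ (coords n (d + 1)).symm) y) = ∑ p : Cube n (d + 1), F p :=
      (Fintype.sum_equiv (coords n (d + 1)) _ _ fun p => by simp).symm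
    rw [e]
    change (∑ p : Fin (n + 1) × Cube n d, f p.1) = 0
    rw [h1, hsum, mul_zero]
  · have e : (∑ y, (F ∘ (coords n (d + 1)).symm) y ^ 2) = ∑ p : Cube n (d + 1), F p ^ 2 :=
      (Fintype.sum_equiv (coords n (d + 1)) (fun p => F p ^ 2) _ fun p => by simp).symm
    rw [e]
    change 0 < ∑ p : Fin (n + 1) × Cube n d, f p.1 ^ 2
    rw [h2]
    have : (0 : ℝ) < Fintype.card (Cube n d) := by exact_mod_cast Fintype.card_pos
    exact mul_pos this hS
  · have e1 := dirichlet_coords n (d + 1) (F ∘ (coords n (d + 1)).symm)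
    have e2 : (∑ b : CubeBond n (d + 1),
        ((F ∘ (coords n (d + 1)).symm) (coords n (d + 1) (cubeTgt n (d + 1) b)) -
          (F ∘ (coords n (d + 1)).symm) (coords n (d + 1) (cubeSrc n (d + 1) b))) ^ 2)
        = dirichlet (cubeSrc n (d + 1)) (cubeTgt n (d + 1)) F := by
      unfold dirichlet
      refine sum_congr rfl fun b _ => ?_
      simp
    have e3 : dirichlet (cubeSrc n (d + 1)) (cubeTgt n (d + 1)) F
        = dirichlet (prodSrc (pathSrc n) (cubeSrc n d)) (prodTgt (pathTgt n) (cubeTgt n d))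
            (fun p : Fin (n + 1) × Cube n d => f p.1) := rfl
    have e4 : (∑ y, (F ∘ (coords n (d + 1)).symm) y ^ 2) = ∑ p : Cube n (d + 1), F p ^ 2 :=
      (Fintype.sum_equiv (coords n (d + 1)) (fun p => F p ^ 2) _ fun p => by simp).symm
    rw [← e1, e2, e3, h3, hdir, e4]
    change _ = (2 - 2 * cos (π / ((n : ℝ) + 1))) * ∑ p : Fin (n + 1) × Cube n d, f p.1 ^ 2
    rw [h2]
    ring

/-! ## §3  The gap constant `γ_s = s²(2 − 2cos(π/s)) = 4s² sin²(π/(2s)) ∈ [8, π²[` -/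

/-- `s²(2 − 2cos(π/s)) = 4s² sin²(π/(2s))` (`s = n + 1`). [folklore] -/
theorem gap_eq (n : ℕ) :
    ((n : ℝ) + 1) ^ 2 * (2 - 2 * cos (π / ((n : ℝ) + 1)))
      = 4 * ((n : ℝ) + 1) ^ 2 * sin (π / (2 * ((n : ℝ) + 1))) ^ 2 := by
  have h := two_sub_two_cos_eq (L := n + 1) (by omega)
  push_cast at h
  calc ((n : ℝ) + 1) ^ 2 * (2 - 2 * cos (π / ((n : ℝ) + 1)))
      = ((n : ℝ) + 1) * (((n : ℝ) + 1) * (2 - 2 * cos (π / ((n : ℝ) + 1)))) := by ring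
    _ = ((n : ℝ) + 1) * (4 * ((n : ℝ) + 1) * sin (π / (2 * ((n : ℝ) + 1))) ^ 2) := by rw [h]
    _ = _ := by ring

/-- `4s² sin²(π/(2s)) < π²` for every `s ≥ 1`: the printed `π²` is never attained. [folklore] -/
theorem gap_lt_pi_sq (n : ℕ) : 4 * ((n : ℝ) + 1) ^ 2 * sin (π / (2 * ((n : ℝ) + 1))) ^ 2 < π ^ 2 := by
  have h := sin_bound_lt_pi_sq_div (L := n + 1) (by omega)
  push_cast at h
  have hn1 : (0 : ℝ) < (n : ℝ) + 1 := by positivity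
  rw [lt_div_iff₀ hn1] at h
  nlinarith [h]

/-- `8 ≤ 4s² sin²(π/(2s))` for every `s ≥ 2` (concavity of `sin` on `[0, π]`: `sin x ≥ (2√2/π)·x` on `[0, π/4]`;
equality at `s = 2`). [folklore] -/
theorem eight_le_gap {n : ℕ} (hn : 1 ≤ n) : 8 ≤ 4 * ((n : ℝ) + 1) ^ 2 * sin (π / (2 * ((n : ℝ) + 1))) ^ 2 := by
  have hn1 : (2 : ℝ) ≤ (n : ℝ) + 1 := by
    have : (1 : ℝ) ≤ n := by exact_mod_cast hn
    linarith
  have hs0 : (0 : ℝ) < (n : ℝ) + 1 := by linarith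
  set x := π / (2 * ((n : ℝ) + 1)) with hx
  -- weights for the chord between 0 and π/4: x = t·(π/4) with t = 2/(n+1)
  set t := 2 / ((n : ℝ) + 1) with ht
  have ht0 : 0 ≤ t := by positivity
  have ht1 : t ≤ 1 := by rw [ht, div_le_one hs0]; exact hn1
  have h0mem : (0 : ℝ) ∈ Set.Icc 0 π := ⟨le_refl 0, pi_pos.le⟩
  have h4mem : π / 4 ∈ Set.Icc 0 π := ⟨by positivity, by linarith [pi_pos]⟩
  have hcv := (strictConcaveOn_sin_Icc).concaveOn.2 h0mem h4mem (by linarith : (0 : ℝ) ≤ 1 - t) ht0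
    (by ring : 1 - t + t = 1)
  simp only [smul_eq_mul, mul_zero, zero_add, sin_zero, sin_pi_div_four] at hcv
  have htx : t * (π / 4) = x := by rw [ht, hx]; field_simp; norm_num
  rw [htx] at hcv
  -- hcv : t * (√2/2) ≤ sin x, and t * (√2/2) = √2/(n+1)
  have hval : t * (Real.sqrt 2 / 2) = Real.sqrt 2 / ((n : ℝ) + 1) := by
    rw [ht]; field_simp
  rw [hval] at hcv
  have hsq2 : Real.sqrt 2 ^ 2 = 2 := Real.sq_sqrt (by norm_num)
  have hpos : 0 ≤ Real.sqrt 2 / ((n : ℝ) + 1) := by positivity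
  have h2 : (Real.sqrt 2 / ((n : ℝ) + 1)) ^ 2 ≤ sin x ^ 2 := pow_le_pow_left₀ hpos hcv 2
  rw [div_pow, hsq2] at h2
  have h3 : 2 ≤ ((n : ℝ) + 1) ^ 2 * sin x ^ 2 := by
    have := mul_le_mul_of_nonneg_left h2 (by positivity : (0 : ℝ) ≤ ((n : ℝ) + 1) ^ 2)
    rwa [mul_div_cancel₀ _ (by positivity : ((n : ℝ) + 1) ^ 2 ≠ 0)] at this
  linarith

/-! ## §4  The concrete block form: the sharp repaired bound, a test configuration, the printed (2.27) decided -/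

/-- (2.27) repaired with the SHARP constant, real-valued, in `ξ`-units on `Δ = {0,…,n}^D`:
`min{4s² sin²(π/(2s)), a}·Σ_y g_y² ≤ s²·Σ_μ Σ_{y μ ≠ last} (g(y+e_μ) − g y)² + a·s^{−D}·(Σ_y g_y)²`
(as `B4Block227.block227_real`, with `poincare_coordCube_sharp` for `poincare_coordCube8`). [folklore] -/
theorem block227_real_sharp (n D : ℕ) (a : ℝ) (g : (Fin D → Fin (n + 1)) → ℝ) :
    min (4 * ((n : ℝ) + 1) ^ 2 * sin (π / (2 * ((n : ℝ) + 1))) ^ 2) a * ∑ y, g y ^ 2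
      ≤ ((n : ℝ) + 1) ^ 2 * ∑ μ : Fin D,
            ∑ y ∈ Finset.univ.filter (fun y : Fin D → Fin (n + 1) => y μ ≠ Fin.last n), (g (stepUp y μ) - g y) ^ 2
        + a * (((n : ℝ) + 1) ^ D)⁻¹ * (∑ y, g y) ^ 2 := by
  have hP := poincare_coordCube_sharp n D g
  set γ := 4 * ((n : ℝ) + 1) ^ 2 * sin (π / (2 * ((n : ℝ) + 1))) ^ 2 with hγ
  set G := ∑ μ : Fin D,
    ∑ y ∈ Finset.univ.filter (fun y : Fin D → Fin (n + 1) => y μ ≠ Fin.last n), (g (stepUp y μ) - g y) ^ 2 with hG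
  set V := ∑ y, (g y - avg Finset.univ g) ^ 2 with hV
  have hcard : ((Finset.univ : Finset (Fin D → Fin (n + 1))).card : ℝ) = ((n : ℝ) + 1) ^ D := by
    rw [Finset.card_univ, Fintype.card_fun, Fintype.card_fin, Fintype.card_fin]; push_cast; ring
  have hc0 : (0 : ℝ) < ((n : ℝ) + 1) ^ D := by positivity
  have hsplit : ∑ y, g y ^ 2 = V + ((n : ℝ) + 1) ^ D * avg Finset.univ g ^ 2 := by
    rw [sum_sq_eq_var_add Finset.univ g, hcard]
  have hmean : a * (((n : ℝ) + 1) ^ D)⁻¹ * (∑ y, g y) ^ 2 = a * (((n : ℝ) + 1) ^ D * avg Finset.univ g ^ 2) := by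
    have : ∑ y, g y = ((n : ℝ) + 1) ^ D * avg Finset.univ g := by
      unfold avg; rw [hcard, ← mul_div_assoc, mul_div_cancel_left₀ _ hc0.ne']
    rw [this]; field_simp
  have hV0 : 0 ≤ V := Finset.sum_nonneg fun y _ => sq_nonneg _
  have hA0 : 0 ≤ ((n : ℝ) + 1) ^ D * avg Finset.univ g ^ 2 := by positivity
  have p1 := mul_le_mul_of_nonneg_right (min_le_left γ a) hV0
  have p2 := mul_le_mul_of_nonneg_right (min_le_right γ a) hA0
  have hpos := two_sub_two_cos_pos n
  have hcV : (2 - 2 * cos (π / ((n : ℝ) + 1))) * V ≤ G := by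
    rw [one_div_mul_eq_div, le_div_iff₀ hpos] at hP
    linarith [hP]
  have hγV : γ * V ≤ ((n : ℝ) + 1) ^ 2 * G := by
    rw [hγ, ← gap_eq n]
    have := mul_le_mul_of_nonneg_left hcV (by positivity : (0 : ℝ) ≤ ((n : ℝ) + 1) ^ 2)
    linarith [this]
  rw [hsplit, hmean]
  linarith [p1, p2, hγV]

/-- The same, complex-valued: `min{4s² sin²(π/(2s)), a}·Σ|φ|² ≤ s²·Σ_{bonds ⊂ Δ}|∇φ|² + a·s^{−D}·|Σ φ|²`
(real and imaginary parts, as `B4Block227.block227`). [folklore] -/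
theorem block227_sharp (n D : ℕ) (a : ℝ) (f : (Fin D → Fin (n + 1)) → ℂ) :
    min (4 * ((n : ℝ) + 1) ^ 2 * sin (π / (2 * ((n : ℝ) + 1))) ^ 2) a * ∑ y, ‖f y‖ ^ 2
      ≤ ((n : ℝ) + 1) ^ 2 * ∑ μ : Fin D,
            ∑ y ∈ Finset.univ.filter (fun y : Fin D → Fin (n + 1) => y μ ≠ Fin.last n), ‖f (stepUp y μ) - f y‖ ^ 2
        + a * (((n : ℝ) + 1) ^ D)⁻¹ * ‖∑ y, f y‖ ^ 2 := by
  have hre := block227_real_sharp n D a (fun y => (f y).re)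
  have him := block227_real_sharp n D a (fun y => (f y).im)
  have e1 : ∀ z : ℂ, ‖z‖ ^ 2 = z.re ^ 2 + z.im ^ 2 := fun z => by
    rw [Complex.sq_norm, Complex.normSq_apply]; ring
  simp only [e1, Complex.sub_re, Complex.sub_im, Complex.re_sum, Complex.im_sum, Finset.sum_add_distrib,
    mul_add] at hre him ⊢
  linarith

/-- **(2.27) REPAIRED WITH THE SHARP CONSTANT** on the concrete block form of `B4Block227`: for every side
`s = n + 1`, dimension `D`, real `a` and `φ : Δ → ℂ`,
`min{4s² sin²(π/(2s)), a}·‖φ‖²_{L²(Δ)} ≤ ⟨φ,(−Δ^{η,N}_Δ + aP_k)φ⟩`. [folklore] -/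
theorem blockForm_ineq_sharp (n D : ℕ) (a : ℝ) (f : (Fin D → Fin (n + 1)) → ℂ) :
    min (4 * ((n : ℝ) + 1) ^ 2 * sin (π / (2 * ((n : ℝ) + 1))) ^ 2) a * (blockForm n D a).l2sq f
      ≤ (blockForm n D a).form f := by
  have h := block227_sharp n D a f
  have hc0 : (0 : ℝ) < ((n : ℝ) + 1) ^ D := by positivity
  dsimp only [blockForm]
  rw [norm_smul, Real.norm_eq_abs, abs_of_pos (inv_pos.mpr hc0), mul_pow]
  have := mul_le_mul_of_nonneg_left h (inv_pos.mpr hc0).le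
  linarith [this]

/-- **A test configuration saturating the gap** (`s = n + 1 ≥ 2`, dimension `D + 1 ≥ 1`): some `φ` with
`‖φ‖²_{L²(Δ)} > 0` and `⟨φ,(−Δ^{η,N}_Δ + aP_k)φ⟩ = 4s² sin²(π/(2s))·‖φ‖²_{L²(Δ)}` (the mean-zero cosine mode in
the first coordinate; the `P_k`-term vanishes). [folklore] -/
theorem blockForm_test {n : ℕ} (hn : 1 ≤ n) (D : ℕ) (a : ℝ) :
    ∃ f : (Fin (D + 1) → Fin (n + 1)) → ℂ,
      0 < (blockForm n (D + 1) a).l2sq f ∧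
      (blockForm n (D + 1) a).form f
        = (4 * ((n : ℝ) + 1) ^ 2 * sin (π / (2 * ((n : ℝ) + 1))) ^ 2) * (blockForm n (D + 1) a).l2sq f := by
  obtain ⟨g, hg0, hgpos, hgdir⟩ := coordCube_test hn D
  refine ⟨fun y => (g y : ℂ), ?_, ?_⟩
  · dsimp only [blockForm]
    have hc0 : (0 : ℝ) < ((n : ℝ) + 1) ^ (D + 1) := by positivity
    have e : (∑ y, ‖((g y : ℝ) : ℂ)‖ ^ 2) = ∑ y, g y ^ 2 :=
      sum_congr rfl fun y _ => by rw [Complex.norm_real, Real.norm_eq_abs, sq_abs]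
    rw [e]
    exact mul_pos (inv_pos.mpr hc0) hgpos
  · dsimp only [blockForm]
    have hc0 : (0 : ℝ) < ((n : ℝ) + 1) ^ (D + 1) := by positivity
    have e : (∑ y, ‖((g y : ℝ) : ℂ)‖ ^ 2) = ∑ y, g y ^ 2 :=
      sum_congr rfl fun y _ => by rw [Complex.norm_real, Real.norm_eq_abs, sq_abs]
    have e2 : ∀ μ : Fin (D + 1), (∑ y ∈ Finset.univ.filter (fun y : Fin (D + 1) → Fin (n + 1) => y μ ≠ Fin.last n),
        ‖((g (stepUp y μ) : ℝ) : ℂ) - ((g y : ℝ) : ℂ)‖ ^ 2)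
        = ∑ y ∈ Finset.univ.filter (fun y : Fin (D + 1) → Fin (n + 1) => y μ ≠ Fin.last n),
            (g (stepUp y μ) - g y) ^ 2 := fun μ =>
      sum_congr rfl fun y _ => by rw [← Complex.ofReal_sub, Complex.norm_real, Real.norm_eq_abs, sq_abs]
    have e3 : (∑ y, ((g y : ℝ) : ℂ)) = 0 := by rw [← Complex.ofReal_sum, hg0]; simp
    simp only [e2]
    rw [e, hgdir, e3, smul_zero, norm_zero]
    rw [← gap_eq n]
    ring

/-- **THE PRINTED (2.27) DECIDED ON THE CONCRETE BLOCK FORMS.**  For a block of side `s = n + 1 ≥ 2` and dimension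
`D + 1 ≥ 1`, the printed display `⟨φ,(−Δ^{η,N}_Δ + aP_k)φ⟩ ≥ min{π², a}‖φ‖²` (`B4.Display227Printed`) holds for every
`φ` IF AND ONLY IF `a ≤ 4s² sin²(π/(2s))` — the Neumann gap of the block.  (Census G-B4-03: true in the paper's regime
`a ≤ 8 ≤ 4s² sin²(π/(2s))`, false as a statement about `−Δ^{η,N}_Δ`, whose gap is `< π²`.) [folklore] -/
theorem display227Printed_blockForm_iff {n : ℕ} (hn : 1 ≤ n) (D : ℕ) (a : ℝ) :
    B4.Display227Printed (fun _ : Unit => blockForm n (D + 1) a)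
      ↔ a ≤ 4 * ((n : ℝ) + 1) ^ 2 * sin (π / (2 * ((n : ℝ) + 1))) ^ 2 := by
  set γ := 4 * ((n : ℝ) + 1) ^ 2 * sin (π / (2 * ((n : ℝ) + 1))) ^ 2 with hγ
  have hγπ : γ < π ^ 2 := gap_lt_pi_sq n
  constructor
  · intro h
    by_contra hlt
    have hlt' : γ < a := not_le.mp hlt
    obtain ⟨f, hpos, hform⟩ := blockForm_test hn D a
    have key : min (π ^ 2) a * (blockForm n (D + 1) a).l2sq f ≤ (blockForm n (D + 1) a).form f := h () f
    have hmin : γ < min (π ^ 2) a := lt_min hγπ hlt'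
    rw [hform] at key
    nlinarith
  · intro ha i f
    have key := blockForm_ineq_sharp n (D + 1) a f
    have h1 : min (π ^ 2) a = a := min_eq_right (by linarith)
    have h2 : min γ a = a := min_eq_right ha
    show min (π ^ 2) a * (blockForm n (D + 1) a).l2sq f ≤ (blockForm n (D + 1) a).form f
    rw [h1]
    rw [h2] at key
    exact key

/-- In particular the printed sentence *"−Δ^{η,N}_Δ is bounded from below by π² on [the mean-zero functions]"*,
read as (2.27) with `a = π²`, FAILS on every block of side `≥ 2` and dimension `≥ 1`. [folklore] -/
theorem not_display227Printed_pi_sq {n : ℕ} (hn : 1 ≤ n) (D : ℕ) :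
    ¬ B4.Display227Printed (fun _ : Unit => blockForm n (D + 1) (π ^ 2)) := by
  rw [display227Printed_blockForm_iff hn D]
  exact not_le.mpr (gap_lt_pi_sq n)

/-- … while for every `a ≤ 8` (the paper's regime, `a` "close to 1") it holds — re-derived here from the sharp
threshold and `8 ≤ 4s² sin²(π/(2s))` (cf. `B4Block227.display227Printed_blockForm`). [folklore] -/
theorem display227Printed_of_le_eight {n : ℕ} (hn : 1 ≤ n) (D : ℕ) {a : ℝ} (ha : a ≤ 8) :
    B4.Display227Printed (fun _ : Unit => blockForm n (D + 1) a) :=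
  (display227Printed_blockForm_iff hn D a).mpr (ha.trans (eight_le_gap hn))

/-- **Summary — the Neumann gap of a block identified** (`s = n + 1 ≥ 2`, dimension `D + 1 ≥ 1`): the best constant
`γ` in `γ·‖φ − mean‖² ≤ s²·Σ_{bonds}|∇φ|²` is `γ_s = 4s² sin²(π/(2s))`, i.e. the optimal Poincaré constant is
`1/(2 − 2cos(π/s)) = s²/γ_s`, and `8 ≤ γ_s < π²`. [folklore] -/
theorem block_gap_identified {n : ℕ} (hn : 1 ≤ n) (D : ℕ) :
    (∀ P : ℝ, PoincareConst (cubeSrc n (D + 1)) (cubeTgt n (D + 1)) P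
        ↔ 1 / (2 - 2 * cos (π / ((n : ℝ) + 1))) ≤ P) ∧
    ((n : ℝ) + 1) ^ 2 * (2 - 2 * cos (π / ((n : ℝ) + 1)))
        = 4 * ((n : ℝ) + 1) ^ 2 * sin (π / (2 * ((n : ℝ) + 1))) ^ 2 ∧
    8 ≤ 4 * ((n : ℝ) + 1) ^ 2 * sin (π / (2 * ((n : ℝ) + 1))) ^ 2 ∧
    4 * ((n : ℝ) + 1) ^ 2 * sin (π / (2 * ((n : ℝ) + 1))) ^ 2 < π ^ 2 :=
  ⟨fun _ => poincare_cube_iff hn D, gap_eq n, eight_le_gap hn, gap_lt_pi_sq n⟩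

end

end Literature.MathematicalPhysics.QuantumFieldTheory.Balaban1983to89.B4Block227Sharp
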